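import Summits.Ventures.DiscreteObjects.Hadamard.Order4Nega
import Summits.Ventures.DiscreteObjects.Hadamard.SqrtTwoNorm4q
import Summits.Ventures.DiscreteObjects.Hadamard.InvolutionCensusUniform

/-!
# H(4q), q ≡ 7 (mod 8) prime: NO AUTOMORPHISM OF ORDER 4 HAS A FIXED-POINT-FREE SQUARE (uniform version; 668 and 892)

Framing: lottery ticket; floor = certified bounds/negative ranges.

Cell pub-namedobj (venture DiscreteObjects), target (H), hadamard gen 13.  Uniform version of `Order4NegaCore` / `Order4Nega`
(`668 = 4·167`) for every order `4q` with `q ≡ 7 (mod 8)` prime — the hypotheses the √2-folding actually uses: `|Fin 2 × R| = 2q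
≡ 2 (mod 4)` and `4q` is not a sum of two squares in `ℚ(√2)` (`SqrtTwoNorm4q`: `2` is a residue and `−2` a non-residue mod
`q`).  `no_hadamard4q_nega4_blockform` (block normal form), `no_hadamard4q_nega4` (transfer via `orbit4_bijective` and
re-signing), `fpf_involution_nega_general` (fixed-point-free involution pairs are nega for n ≡ 4 (mod 8), n ≠ x² + y²),
**`no_hadamard4q_aut_order4_sq_fpf`** (π⁴ = κ⁴ = 1 ⇒ π², κ² not both fixed-point-free), and the instance
`no_hadamard892_aut_order4_sq_fpf` for the open order `892`.  (`716 = 4·179`, `179 ≡ 3 (mod 8)`, is not covered: there the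
argument has no obstruction.)  Ours; no `sorry`.
-/

namespace Summit.Ventures.DiscreteObjects.Hadamard

open Finset BigOperators Matrix QuadraticAlgebra

open Literature.Combinatorics.Designs.GoethalsSeidel (IsHadamardMatrix)

section core
variable {R : Type*} [Fintype R] [DecidableEq R]

/-- **No H(4q), `q ≡ 7 (mod 8)` prime, in block normal form with the standard nega 4-cycle symmetry.**  On `Fin 4 × R`, `|R| = q`,
no Hadamard matrix admits the signed automorphism `(σ, σ, d₀, d₀)` with `σ (p, c) = (p + 1, c)` and
`d₀ (p, c) = −1` for `p = 3`, `+1` otherwise (so the signed permutation matrices satisfy `P⁴ = −I`). -/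
theorem no_hadamard4q_nega4_blockform {q : ℕ} (hq : q.Prime) (hq8 : q % 8 = 7) (hR : Fintype.card R = q) (H : Matrix (Fin 4 × R) (Fin 4 × R) ℤ)
    (hH : IsHadamardMatrix H)
    (haut : IsSignedAut H ((finRotate 4).prodCongr (Equiv.refl R)) ((finRotate 4).prodCongr (Equiv.refl R))
      (fun x => if x.1 = 3 then -1 else 1) (fun x => if x.1 = 3 then -1 else 1)) : False := by
  haveI := sqrtTwo_field_fact
  -- the field ℚ(√2) and r = √2
  set r : QuadraticAlgebra ℚ 2 0 := ω with hrdef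
  have hr2 : r * r = 2 := by
    rw [hrdef, omega_mul_omega_eq_mk]; ext <;> simp
  set σ : Equiv.Perm (Fin 4 × R) := (finRotate 4).prodCongr (Equiv.refl R) with hσdef
  set d₀ : Fin 4 × R → ℤ := fun x => if x.1 = 3 then -1 else 1 with hd₀def
  have hσ : ∀ x : Fin 4 × R, σ x = (x.1 + 1, x.2) := by
    rintro ⟨p, c⟩
    rw [hσdef, Equiv.prodCongr_apply, Prod.map_apply]
    simp [finRotate_apply]
  -- cardinalities
  have hcard : Fintype.card (Fin 4 × R) = 4 * q := by rw [Fintype.card_prod, Fintype.card_fin, hR]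
  have hα : Fintype.card (Fin 2 × R) % 4 = 2 := by rw [Fintype.card_prod, Fintype.card_fin, hR]; omega
  -- H over F
  set Hq : Matrix (Fin 4 × R) (Fin 4 × R) (QuadraticAlgebra ℚ 2 0) := H.map (Int.castRingHom _) with hHqdef
  have hHq : Hq * Hqᵀ = ((4 * q : ℕ) : QuadraticAlgebra ℚ 2 0) • (1 : Matrix _ _ _) := by
    have h1 : Hq * Hqᵀ = (H * Hᵀ).map (Int.castRingHom _) := by
      rw [Matrix.map_mul, hHqdef, transpose_map]
    rw [h1, hH.2, hcard]
    ext i j : 1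
    rw [Matrix.map_apply, Matrix.smul_apply, Matrix.smul_apply, Matrix.one_apply, Matrix.one_apply]
    split_ifs <;> simp
  -- the blocks
  set N₀ : Matrix (Fin 4) (Fin 4) (QuadraticAlgebra ℚ 2 0) :=
    fun k i => if k = i + 1 then (if i = 3 then -1 else 1) else 0 with hN₀def
  set U₀ : Matrix (Fin 2) (Fin 4) (QuadraticAlgebra ℚ 2 0) :=
    !![2, r, 0, -r; 0, r, 2, r] with hU₀def
  have hA1 : U₀ * U₀ᵀ = (8 : QuadraticAlgebra ℚ 2 0) • (1 : Matrix (Fin 2) (Fin 2) _) := by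
    ext i j <;> fin_cases i <;> fin_cases j <;>
      simp [hU₀def, hrdef, Matrix.mul_apply, Fin.sum_univ_four] <;> norm_num
  have hA2 : U₀ᵀ * U₀ = (4 : QuadraticAlgebra ℚ 2 0) • 1 + ((2 : QuadraticAlgebra ℚ 2 0) * r) • (N₀ + N₀ᵀ) := by
    ext i j <;> fin_cases i <;> fin_cases j <;>
      simp [hU₀def, hN₀def, hrdef, Matrix.mul_apply, Fin.sum_univ_two, Matrix.add_apply] <;> norm_num
  -- global block-diagonal matrices
  set P : Matrix (Fin 4 × R) (Fin 4 × R) (QuadraticAlgebra ℚ 2 0) := blockDiagonal (fun _ : R => N₀) with hPdef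
  have hPspec : ∀ k i : Fin 4 × R, P k i = if k = σ i then (d₀ i : QuadraticAlgebra ℚ 2 0) else 0 := by
    rintro ⟨k, c⟩ ⟨i, c'⟩
    by_cases hc : c = c'
    · subst hc
      rw [hPdef, blockDiagonal_apply_eq, hσ]
      dsimp only
      have e1 : ((k, c) = (i + 1, c)) = (k = i + 1) := by
        rw [Prod.mk.injEq]; simp
      simp only [hN₀def, hd₀def, e1]
      split_ifs <;> simp
    · rw [hPdef, blockDiagonal_apply_ne _ _ _ hc, hσ]
      dsimp only
      rw [if_neg (fun h => hc (congrArg Prod.snd h))]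
  have hPH : P * Hq = Hq * P := sgnPerm_intertwine_gen haut P P hPspec hPspec
  have hPtH : Pᵀ * Hq = Hq * Pᵀ := sgnPerm_transpose_intertwine_gen haut P P hPspec hPspec
  set S : Matrix (Fin 4 × R) (Fin 4 × R) (QuadraticAlgebra ℚ 2 0) := P + Pᵀ with hSdef
  clear_value S
  have hS : S = blockDiagonal (fun _ : R => N₀ + N₀ᵀ) := by
    rw [hSdef, hPdef, blockDiagonal_transpose, ← blockDiagonal_add]
    rfl
  have hHS : Hq * S = S * Hq := by
    rw [hSdef, Matrix.mul_add, Matrix.add_mul, ← hPH, ← hPtH]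
  set U : Matrix (Fin 2 × R) (Fin 4 × R) (QuadraticAlgebra ℚ 2 0) := blockDiagonal (fun _ : R => U₀) with hUdef
  set Rm : Matrix (Fin 4 × R) (Fin 4 × R) (QuadraticAlgebra ℚ 2 0) :=
    (4 : QuadraticAlgebra ℚ 2 0) • 1 + ((2 : QuadraticAlgebra ℚ 2 0) * r) • S with hRmdef
  have hRm : Rm = blockDiagonal (fun _ : R => (4 : QuadraticAlgebra ℚ 2 0) • 1 +
      ((2 : QuadraticAlgebra ℚ 2 0) * r) • (N₀ + N₀ᵀ)) := by
    rw [hRmdef, hS]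
    have e1 : (fun _ : R => (4 : QuadraticAlgebra ℚ 2 0) • (1 : Matrix (Fin 4) (Fin 4) (QuadraticAlgebra ℚ 2 0)) +
        ((2 : QuadraticAlgebra ℚ 2 0) * r) • (N₀ + N₀ᵀ))
        = (4 : QuadraticAlgebra ℚ 2 0) • (1 : R → Matrix (Fin 4) (Fin 4) _) +
          ((2 : QuadraticAlgebra ℚ 2 0) * r) • (fun _ : R => N₀ + N₀ᵀ) := rfl
    rw [e1, blockDiagonal_add, blockDiagonal_smul, blockDiagonal_smul, blockDiagonal_one]
  -- the folding hypotheses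
  have hUU : U * Uᵀ = (8 : QuadraticAlgebra ℚ 2 0) • (1 : Matrix (Fin 2 × R) (Fin 2 × R) _) := by
    rw [hUdef, blockDiagonal_transpose, ← blockDiagonal_mul]
    have e1 : (fun _ : R => U₀ * U₀ᵀ) = (8 : QuadraticAlgebra ℚ 2 0) • (1 : R → Matrix (Fin 2) (Fin 2) _) := by
      funext c; rw [hA1]; rfl
    rw [e1, blockDiagonal_smul, blockDiagonal_one]
  have hV : Uᵀ * U = Rm := by
    rw [hRm, hUdef, blockDiagonal_transpose, ← blockDiagonal_mul]
    congr 1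
    funext c
    exact hA2
  have hHR : Hq * Rm * Hqᵀ = ((4 * q : ℕ) : QuadraticAlgebra ℚ 2 0) • Rm := by
    have h2 : Hq * S * Hqᵀ = ((4 * q : ℕ) : QuadraticAlgebra ℚ 2 0) • S := by
      rw [hHS, Matrix.mul_assoc, hHq, Matrix.mul_smul, Matrix.mul_one]
    rw [hRmdef]
    calc Hq * ((4 : QuadraticAlgebra ℚ 2 0) • 1 + ((2 : QuadraticAlgebra ℚ 2 0) * r) • S) * Hqᵀ
        = (4 : QuadraticAlgebra ℚ 2 0) • (Hq * Hqᵀ) + ((2 : QuadraticAlgebra ℚ 2 0) * r) • (Hq * S * Hqᵀ) := by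
          simp only [Matrix.mul_add, Matrix.add_mul, Matrix.mul_smul, Matrix.smul_mul, Matrix.mul_one]
      _ = (4 : QuadraticAlgebra ℚ 2 0) • (((4 * q : ℕ) : QuadraticAlgebra ℚ 2 0) • (1 : Matrix _ _ _)) +
            ((2 : QuadraticAlgebra ℚ 2 0) * r) • (((4 * q : ℕ) : QuadraticAlgebra ℚ 2 0) • S) := by rw [hHq, h2]
      _ = ((4 * q : ℕ) : QuadraticAlgebra ℚ 2 0) • ((4 : QuadraticAlgebra ℚ 2 0) • 1 +
            ((2 : QuadraticAlgebra ℚ 2 0) * r) • S) := by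
          rw [smul_add (((4 * q : ℕ)) : QuadraticAlgebra ℚ 2 0) ((4 : QuadraticAlgebra ℚ 2 0) • (1 : Matrix _ _ _))
              (((2 : QuadraticAlgebra ℚ 2 0) * r) • S),
            smul_smul, smul_smul, smul_smul, smul_smul, mul_comm (4 : QuadraticAlgebra ℚ 2 0),
            mul_comm ((2 : QuadraticAlgebra ℚ 2 0) * r)]
  have hU : U * Rm * Uᵀ = ((8 : QuadraticAlgebra ℚ 2 0) ^ 2) • (1 : Matrix (Fin 2 × R) (Fin 2 × R) _) := by
    rw [← hV]
    calc U * (Uᵀ * U) * Uᵀ = (U * Uᵀ) * (U * Uᵀ) := by simp only [Matrix.mul_assoc]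
      _ = ((8 : QuadraticAlgebra ℚ 2 0) ^ 2) • (1 : Matrix (Fin 2 × R) (Fin 2 × R) _) := by
          rw [hUU, Matrix.smul_mul, Matrix.one_mul, smul_smul, pow_two]
  have h8 : (8 : QuadraticAlgebra ℚ 2 0) ≠ 0 := by
    intro h; have := congrArg QuadraticAlgebra.re h; simp at this
  obtain ⟨u, v, huv⟩ := folding_two_squares_field Hq Rm Rm U U (4 * q) (8 : QuadraticAlgebra ℚ 2 0) h8
    hV hHR hU (Equiv.refl _) hα
  exact not_sum_two_sq_4q_sqrtTwo hq hq8 ⟨u, v, by rw [huv]; push_cast; ring⟩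

end core

section transfer
variable {ι : Type*} [Fintype ι] [DecidableEq ι]

/-- **No H(4q), `q ≡ 7 (mod 8)` prime, with a nega automorphism of permutation order 4 acting by 4-cycles** (ordered index type). -/
theorem no_hadamard4q_nega4_ord [LinearOrder ι] {q : ℕ} (hq : q.Prime) (hq8 : q % 8 = 7) {H : Matrix ι ι ℤ}
    (hH : IsHadamardMatrix H) (hι : Fintype.card ι = 4 * q) {π κ : Equiv.Perm ι} {d e : ι → ℤ} (haut : IsSignedAut H π κ d e)
    (hπ4 : ∀ i, π (π (π (π i))) = i) (hκ4 : ∀ j, κ (κ (κ (κ j))) = j)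
    (hπ2 : ∀ i, π (π i) ≠ i) (hκ2 : ∀ j, κ (κ j) ≠ j)
    (hdneg : ∀ i, d i * d (π i) * d (π (π i)) * d (π (π (π i))) = -1)
    (heneg : ∀ j, e j * e (κ j) * e (κ (κ j)) * e (κ (κ (κ j))) = -1) : False := by
  have hd := haut.1
  have he := haut.2.1
  have hA := haut.2.2
  have pm_mul : ∀ {a b : ℤ}, (a = 1 ∨ a = -1) → (b = 1 ∨ b = -1) → (a * b = 1 ∨ a * b = -1) := by
    intro a b ha hb
    rcases ha with h | h <;> rcases hb with h' | h' <;> simp [h, h']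
  -- the two orbit bijections
  set Rr := univ.filter (fun c => c < π c ∧ c < π (π c) ∧ c < π (π (π c))) with hRr
  set Rc := univ.filter (fun c => c < κ c ∧ c < κ (κ c) ∧ c < κ (κ (κ c))) with hRc
  let φr : Fin 4 × {c // c ∈ Rr} → ι := fun x => (π ^ (x.1 : ℕ)) x.2.1
  let φc : Fin 4 × {c // c ∈ Rc} → ι := fun x => (κ ^ (x.1 : ℕ)) x.2.1
  have hbr : Function.Bijective φr := orbit4_bijective π hπ4 hπ2
  have hbc : Function.Bijective φc := orbit4_bijective κ hκ4 hκ2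
  let eR : Fin 4 × {c // c ∈ Rr} ≃ ι := Equiv.ofBijective φr hbr
  let eC' : Fin 4 × {c // c ∈ Rc} ≃ ι := Equiv.ofBijective φc hbc
  have hcardR : Fintype.card {c // c ∈ Rr} = q := by
    have h := Fintype.card_congr eR
    rw [Fintype.card_prod, Fintype.card_fin, hι] at h
    omega
  have hcardC : Fintype.card {c // c ∈ Rc} = Fintype.card {c // c ∈ Rr} := by
    have h := Fintype.card_congr eC'
    rw [Fintype.card_prod, Fintype.card_fin, hι] at h
    omega
  obtain ⟨g⟩ : Nonempty ({c // c ∈ Rr} ≃ {c // c ∈ Rc}) := Fintype.card_eq.mp hcardC.symm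
  let eC : Fin 4 × {c // c ∈ Rr} ≃ ι := ((Equiv.refl (Fin 4)).prodCongr g).trans eC'
  -- intertwining with the shift
  set σ : Equiv.Perm (Fin 4 × {c // c ∈ Rr}) := (finRotate 4).prodCongr (Equiv.refl _) with hσdef
  have hσ : ∀ x : Fin 4 × {c // c ∈ Rr}, σ x = (x.1 + 1, x.2) := by
    rintro ⟨p, c⟩
    rw [hσdef, Equiv.prodCongr_apply, Prod.map_apply]
    simp [finRotate_apply]
  have p2 : ∀ (τ : Equiv.Perm ι) i, (τ ^ 2) i = τ (τ i) := fun τ i => by simp [pow_two]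
  have p3 : ∀ (τ : Equiv.Perm ι) i, (τ ^ 3) i = τ (τ (τ i)) := fun τ i => by simp [pow_succ]
  have heR : ∀ x, eR (σ x) = π (eR x) := by
    rintro ⟨p, c⟩
    rw [hσ]
    show (π ^ ((p + 1 : Fin 4) : ℕ)) c.1 = π ((π ^ (p : ℕ)) c.1)
    fin_cases p <;> simp [p2, p3, hπ4]
  have heC : ∀ x, eC (σ x) = κ (eC x) := by
    rintro ⟨p, c⟩
    rw [hσ]
    show (κ ^ ((p + 1 : Fin 4) : ℕ)) (g c).1 = κ ((κ ^ (p : ℕ)) (g c).1)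
    fin_cases p <;> simp [p2, p3, hκ4]
  have heR0 : ∀ p (c : {c // c ∈ Rr}), eR (p, c) = (π ^ (p : ℕ)) c.1 := fun p c => rfl
  have heC0 : ∀ p (c : {c // c ∈ Rr}), eC (p, c) = (κ ^ (p : ℕ)) (g c).1 := fun p c => rfl
  -- re-signing
  set δ : Fin 4 × {c // c ∈ Rr} → ℤ := fun x =>
    if x.1 = 0 then 1 else if x.1 = 1 then d x.2.1 else if x.1 = 2 then d x.2.1 * d (π x.2.1)
      else d x.2.1 * d (π x.2.1) * d (π (π x.2.1)) with hδdef
  set ε : Fin 4 × {c // c ∈ Rr} → ℤ := fun x =>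
    if x.1 = 0 then 1 else if x.1 = 1 then e (g x.2).1 else if x.1 = 2 then e (g x.2).1 * e (κ (g x.2).1)
      else e (g x.2).1 * e (κ (g x.2).1) * e (κ (κ (g x.2).1)) with hεdef
  set d₀ : Fin 4 × {c // c ∈ Rr} → ℤ := fun x => if x.1 = 3 then -1 else 1 with hd₀def
  have hδpm : ∀ x, δ x = 1 ∨ δ x = -1 := by
    rintro ⟨p, c⟩
    fin_cases p <;> simp only [hδdef] <;> simp
    · exact hd _
    · exact pm_mul (hd _) (hd _)
    · exact pm_mul (pm_mul (hd _) (hd _)) (hd _)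
  have hεpm : ∀ x, ε x = 1 ∨ ε x = -1 := by
    rintro ⟨p, c⟩
    fin_cases p <;> simp only [hεdef] <;> simp
    · exact he _
    · exact pm_mul (he _) (he _)
    · exact pm_mul (pm_mul (he _) (he _)) (he _)
  have hδkey : ∀ x, δ (σ x) * d (eR x) = d₀ x * δ x := by
    rintro ⟨p, c⟩
    rw [hσ, heR0]
    fin_cases p <;> simp only [hδdef, hd₀def] <;> simp [p2, p3]
    · exact pm_mul_self (hd _)
    · have := pm_mul_self (hd (π c.1)); linear_combination (d c.1) * this
    · have := pm_mul_self (hd (π (π c.1))); linear_combination (d c.1 * d (π c.1)) * this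
    · have h1 := hdneg c.1
      have h2 := pm_mul_self (hd c.1)
      have h3 := pm_mul_self (hd (π c.1))
      have h4 := pm_mul_self (hd (π (π c.1)))
      rcases hd c.1 with a | a <;> rcases hd (π c.1) with b | b <;> rcases hd (π (π c.1)) with f | f <;>
        rcases hd (π (π (π c.1))) with k | k <;> simp [a, b, f, k] at h1 ⊢
  have hεkey : ∀ x, ε (σ x) * e (eC x) = d₀ x * ε x := by
    rintro ⟨p, c⟩
    rw [hσ, heC0]
    fin_cases p <;> simp only [hεdef, hd₀def] <;> simp [p2, p3]
    · exact pm_mul_self (he _)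
    · have := pm_mul_self (he (κ (g c).1)); linear_combination (e (g c).1) * this
    · have := pm_mul_self (he (κ (κ (g c).1))); linear_combination (e (g c).1 * e (κ (g c).1)) * this
    · have h1 := heneg (g c).1
      rcases he (g c).1 with a | a <;> rcases he (κ (g c).1) with b | b <;> rcases he (κ (κ (g c).1)) with f | f <;>
        rcases he (κ (κ (κ (g c).1))) with k | k <;> simp [a, b, f, k] at h1 ⊢
  -- the transported, re-signed matrix
  set H' : Matrix (Fin 4 × {c // c ∈ Rr}) (Fin 4 × {c // c ∈ Rr}) ℤ :=
    fun x y => δ x * ε y * H (eR x) (eC y) with hH'def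
  have hH' : IsHadamardMatrix H' := by
    refine ⟨fun x y => ?_, ?_⟩
    · rw [hH'def]
      exact pm_mul (pm_mul (hδpm x) (hεpm y)) (hH.1 _ _)
    · ext x x'
      rw [Matrix.mul_apply, Matrix.smul_apply, Matrix.one_apply]
      simp only [hH'def, transpose_apply, smul_eq_mul]
      have e1 : ∑ y, δ x * ε y * H (eR x) (eC y) * (δ x' * ε y * H (eR x') (eC y))
          = δ x * δ x' * ∑ y, H (eR x) (eC y) * H (eR x') (eC y) := by
        rw [Finset.mul_sum]
        refine Finset.sum_congr rfl fun y _ => ?_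
        have := pm_mul_self (hεpm y)
        linear_combination (δ x * δ x' * H (eR x) (eC y) * H (eR x') (eC y)) * this
      rw [e1, Equiv.sum_comp eC (fun j => H (eR x) j * H (eR x') j)]
      rw [Fintype.card_congr eR]
      by_cases hxx : x = x'
      · subst hxx
        rw [hadamard_row_self H hH, if_pos rfl, pm_mul_self (hδpm x), one_mul, mul_one]
      · have hne : eR x ≠ eR x' := fun h => hxx (eR.injective h)
        rw [hadamard_row_orth H hH hne, if_neg hxx, mul_zero, mul_zero]
  have haut' : IsSignedAut H' σ σ d₀ d₀ := by
    refine ⟨fun x => ?_, fun x => ?_, fun x y => ?_⟩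
    · simp only [hd₀def]; split_ifs <;> simp
    · simp only [hd₀def]; split_ifs <;> simp
    · show δ (σ x) * ε (σ y) * H (eR (σ x)) (eC (σ y)) = d₀ x * d₀ y * (δ x * ε y * H (eR x) (eC y))
      rw [heR, heC, hA]
      have h1 := hδkey x
      have h2 := hεkey y
      linear_combination (ε (σ y) * e (eC y) * H (eR x) (eC y)) * h1 + (d₀ x * δ x * H (eR x) (eC y)) * h2
  exact no_hadamard4q_nega4_blockform hq hq8 hcardR H' hH' haut'

/-- **No H(4q), `q ≡ 7 (mod 8)` prime, with a nega automorphism of permutation order 4 acting by 4-cycles.** -/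
theorem no_hadamard4q_nega4 {q : ℕ} (hq : q.Prime) (hq8 : q % 8 = 7) {H : Matrix ι ι ℤ} (hH : IsHadamardMatrix H)
    (hι : Fintype.card ι = 4 * q) {π κ : Equiv.Perm ι} {d e : ι → ℤ} (haut : IsSignedAut H π κ d e)
    (hπ4 : ∀ i, π (π (π (π i))) = i) (hκ4 : ∀ j, κ (κ (κ (κ j))) = j)
    (hπ2 : ∀ i, π (π i) ≠ i) (hκ2 : ∀ j, κ (κ j) ≠ j)
    (hdneg : ∀ i, d i * d (π i) * d (π (π i)) * d (π (π (π i))) = -1)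
    (heneg : ∀ j, e j * e (κ j) * e (κ (κ j)) * e (κ (κ (κ j))) = -1) : False := by
  classical
  letI : LinearOrder ι := LinearOrder.lift' (Fintype.equivFin ι) (Fintype.equivFin ι).injective
  exact no_hadamard4q_nega4_ord hq hq8 hH hι haut hπ4 hκ4 hπ2 hκ2 hdneg heneg

/-- **Fixed-point-free involution pairs are nega** for every Hadamard matrix of order `n ≡ 4 (mod 8)`, `n ≠ x² + y²`
(extracted from `hadamard_involution_census_uniform`). -/
theorem fpf_involution_nega_general {H : Matrix ι ι ℤ} (hH : IsHadamardMatrix H) (hmod : Fintype.card ι % 8 = 4)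
    (hns : ¬ ∃ x y : ℕ, Fintype.card ι = x ^ 2 + y ^ 2) {π κ : Equiv.Perm ι} {d e : ι → ℤ}
    (haut : IsSignedAut H π κ d e) (hπinv : ∀ i, π (π i) = i) (hκinv : ∀ j, κ (κ j) = j)
    (hπf : ∀ i, π i ≠ i) (hκf : ∀ j, κ j ≠ j) :
    (∀ i, d (π i) = -d i) ∧ (∀ j, e (κ j) = -e j) := by
  have hd := haut.1
  have he := haut.2.1
  obtain ⟨i₀⟩ : Nonempty ι := Fintype.card_pos_iff.mp (by omega)
  have hsq := signedAut_sq_sign hH.1 haut hπinv hκinv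
  by_cases hε0 : d (π i₀) = d i₀
  · exfalso
    have hcol : ∀ j, e (κ j) = e j := by
      intro j
      have h := hsq i₀ j
      rw [hε0, pm_mul_self (hd i₀), one_mul] at h
      exact (pm_eq_of_mul_eq_one (he j) (he (κ j)) h).symm
    have hrow : ∀ i, d (π i) = d i := by
      intro i
      have h := hsq i i₀
      rw [hcol i₀, pm_mul_self (he i₀), mul_one] at h
      exact (pm_eq_of_mul_eq_one (hd i) (hd (π i)) h).symm
    exact no_fpf_involution_pos hH hmod hns haut hπinv hκinv hπf hκf hrow
  · have hneg0 : d (π i₀) = -d i₀ := by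
      rcases hd (π i₀) with h1 | h1 <;> rcases hd i₀ with h2 | h2 <;> simp_all
    have hprod0 : d i₀ * d (π i₀) = -1 := by
      rw [hneg0]; have := pm_mul_self (hd i₀); linarith [this, sq_nonneg (d i₀)]
    have hcol : ∀ j, e (κ j) = -e j := by
      intro j
      have h := hsq i₀ j
      rw [hprod0] at h
      have h2 : e j * e (κ j) = -1 := by linarith
      rcases he j with h3 | h3 <;> rcases he (κ j) with h4 | h4 <;> simp_all
    have hrow : ∀ i, d (π i) = -d i := by
      intro i
      have h := hsq i i₀
      have h2 : e i₀ * e (κ i₀) = -1 := by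
        rw [hcol i₀]; have := pm_mul_self (he i₀); linarith
      rw [h2] at h
      have h3 : d i * d (π i) = -1 := by linarith
      rcases hd i with h4 | h4 <;> rcases hd (π i) with h5 | h5 <;> simp_all
    exact ⟨hrow, hcol⟩

/-- **H(4q), `q ≡ 7 (mod 8)` prime: no automorphism of order 4 has a fixed-point-free square.**  For a signed automorphism
`(π, κ, d, e)` of a Hadamard matrix of order `4q` with `π⁴ = κ⁴ = 1`, the squares `π²`, `κ²` are not both fixed-point-free.
Covers the open orders `668 = 4·167` and `892 = 4·223` (and `28, 92, 124, 188, 284, 316, …`); NOT `716 = 4·179`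
(`179 ≡ 3 (mod 8)`: no obstruction from this argument). -/
theorem no_hadamard4q_aut_order4_sq_fpf {q : ℕ} (hq : q.Prime) (hq8 : q % 8 = 7) {H : Matrix ι ι ℤ}
    (hH : IsHadamardMatrix H) (hι : Fintype.card ι = 4 * q) {π κ : Equiv.Perm ι} {d e : ι → ℤ}
    (haut : IsSignedAut H π κ d e) (hπ4 : ∀ i, π (π (π (π i))) = i) (hκ4 : ∀ j, κ (κ (κ (κ j))) = j)
    (hπ2 : ∀ i, π (π i) ≠ i) (hκ2 : ∀ j, κ (κ j) ≠ j) : False := by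
  have hd := haut.1
  have he := haut.2.1
  have hA := haut.2.2
  have pm_mul : ∀ {a b : ℤ}, (a = 1 ∨ a = -1) → (b = 1 ∨ b = -1) → (a * b = 1 ∨ a * b = -1) := by
    intro a b ha hb
    rcases ha with h | h <;> rcases hb with h' | h' <;> simp [h, h']
  have hmod : Fintype.card ι % 8 = 4 := by rw [hι]; omega
  have hns : ¬ ∃ x y : ℕ, Fintype.card ι = x ^ 2 + y ^ 2 := by
    rw [hι]; exact not_sq_add_sq_four_mul_nat (by omega)
  -- the square as a signed automorphism
  have haut2 : IsSignedAut H (π ^ 2) (κ ^ 2) (fun i => d i * d (π i)) (fun j => e j * e (κ j)) := by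
    refine ⟨fun i => pm_mul (hd i) (hd (π i)), fun j => pm_mul (he j) (he (κ j)), fun i j => ?_⟩
    have p2π : (π ^ 2) i = π (π i) := by simp [pow_two]
    have p2κ : (κ ^ 2) j = κ (κ j) := by simp [pow_two]
    rw [p2π, p2κ, hA, hA]
    ring
  have hπ2inv : ∀ i, (π ^ 2) ((π ^ 2) i) = i := fun i => by simp [pow_two, hπ4]
  have hκ2inv : ∀ j, (κ ^ 2) ((κ ^ 2) j) = j := fun j => by simp [pow_two, hκ4]
  have hπ2f : ∀ i, (π ^ 2) i ≠ i := fun i => by simp [pow_two, hπ2]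
  have hκ2f : ∀ j, (κ ^ 2) j ≠ j := fun j => by simp [pow_two, hκ2]
  obtain ⟨hrow, hcol⟩ := fpf_involution_nega_general hH hmod hns haut2 hπ2inv hκ2inv hπ2f hκ2f
  have hdneg : ∀ i, d i * d (π i) * d (π (π i)) * d (π (π (π i))) = -1 := by
    intro i
    have h := hrow i
    simp only [pow_two, Equiv.Perm.mul_apply] at h
    have := pm_mul_self (pm_mul (hd i) (hd (π i)))
    linear_combination (d i * d (π i)) * h - this
  have heneg : ∀ j, e j * e (κ j) * e (κ (κ j)) * e (κ (κ (κ j))) = -1 := by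
    intro j
    have h := hcol j
    simp only [pow_two, Equiv.Perm.mul_apply] at h
    have := pm_mul_self (pm_mul (he j) (he (κ j)))
    linear_combination (e j * e (κ j)) * h - this
  exact no_hadamard4q_nega4 hq hq8 hH hι haut hπ4 hκ4 hπ2 hκ2 hdneg heneg

/-- **H(892) instance** (`q = 223 ≡ 7 (mod 8)`): no automorphism of order 4 of a Hadamard matrix of order `892` has a
fixed-point-free square. -/
theorem no_hadamard892_aut_order4_sq_fpf {H : Matrix ι ι ℤ} (hH : IsHadamardMatrix H) (hι : Fintype.card ι = 892)
    {π κ : Equiv.Perm ι} {d e : ι → ℤ} (haut : IsSignedAut H π κ d e)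
    (hπ4 : ∀ i, π (π (π (π i))) = i) (hκ4 : ∀ j, κ (κ (κ (κ j))) = j)
    (hπ2 : ∀ i, π (π i) ≠ i) (hκ2 : ∀ j, κ (κ j) ≠ j) : False :=
  no_hadamard4q_aut_order4_sq_fpf (q := 223) (by norm_num) (by norm_num) hH (by rw [hι]) haut hπ4 hκ4 hπ2 hκ2

end transfer

end Summit.Ventures.DiscreteObjects.Hadamard
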